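import Mathlib
import Literature.Analysis.FluidPDE.LoopCirculation
import Summits.NavierStokesRegularity.NavierStokesRegularity.Theorems.TautLoopKelvinTautLoopLawLevelLeftContinuity
import HarnessLib

/-!
# Route `TautLoopKelvin`, crux `TautLoopLaw` (stmt-NavierStokesRegularity-15249), line
  `Sketch-ideas-r1k1` (Dini–Saks architecture) — tools stub `stub_tautLoopStepLoopSideTools`

**Loop-side bookkeeping for the random-walk selection.** Four small facts about closed `C¹`
loops `γ : ℝ → ℝ³` (read on `[0, 1]`, `1`-periodic) and the circulation
`∮_γ v · dℓ = ∫₀¹ ⟪v(γ σ), γ′ σ⟫ dσ` (`Literature.Analysis.FluidPDE.circulation`):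

1. gradient fields have zero circulation: `∮_γ ∇Q · dℓ = Q(γ 1) − Q(γ 0) = 0` for a `C¹`
   potential `Q` (chain rule `d/dσ Q(γ σ) = ⟪∇Q(γ σ), γ′ σ⟫` and the fundamental theorem of
   calculus);
2. the orientation reversal `σ ↦ γ(1 − σ)` is again a closed `C¹` loop, has the same length
   `∫₀¹ ‖γ′‖` and the same compression numerator `∫₀¹ −⟪γ′, Dv(γ) γ′⟫ / ‖γ′‖` (its velocity is
   `−γ′(1 − σ)`, both integrands are even in `γ′`, substitution `σ ↦ 1 − σ` on `[0, 1]`), and the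
   opposite circulation (tree `circulation_comp_one_sub`);
3. `|∮_γ v · dℓ| ≤ B · ∫₀¹ ‖γ′‖` whenever `‖v‖ ≤ B` along `γ`
   (tree `tautLoopLlc_abs_circulation_le`);
4. the pull-back of an exact `1`-form is exact: `(DA(x))† ∇Q(A x) = ∇(Q ∘ A)(x)` for a `C¹` map
   `A` and a differentiable `Q` (both sides pair with `e` to `DQ(A x)(DA(x) e)`).

All folklore (A. J. Majda, A. L. Bertozzi, *Vorticity and Incompressible Flow* (2002), §1.6;
P. G. Saffman, *Vortex Dynamics* (1992), §1.4); proved from Mathlib and the tree's loop API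
(`Literature/Analysis/FluidPDE/LoopCirculation.lean`).
-/

noncomputable section

open Set MeasureTheory Function intervalIntegral InnerProductSpace Literature.Analysis.FluidPDE
open ContinuousLinearMap (adjoint)
open scoped InnerProductSpace RealInnerProductSpace

namespace Summit.NavierStokesRegularity.NavierStokesRegularity.Theorems

set_option linter.dupNamespace false

local notation3 "E3" => EuclideanSpace ℝ (Fin 3)

/-! ## Gradient fields have zero circulation -/

/-- The gradient of a `C¹` scalar function on `ℝ³` is continuous. [folklore] -/
theorem tautLoopLoop_continuous_gradient {Q : E3 → ℝ} (hQ : ContDiff ℝ 1 Q) :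
    Continuous (gradient Q) :=
  (InnerProductSpace.toDual ℝ E3).symm.continuous.comp (hQ.continuous_fderiv one_ne_zero)

/-- Chain rule along a curve, gradient form: `d/dσ Q(γ σ) = ⟪∇Q(γ σ), γ′ σ⟫`. [folklore] -/
theorem tautLoopLoop_hasDerivAt_comp_curve {Q : E3 → ℝ} {γ : ℝ → E3} {σ : ℝ}
    (hQ : DifferentiableAt ℝ Q (γ σ)) (hγ : DifferentiableAt ℝ γ σ) :
    HasDerivAt (fun s => Q (γ s)) ⟪gradient Q (γ σ), deriv γ σ⟫ σ := by
  have h := hQ.hasFDerivAt.comp_hasDerivAt σ hγ.hasDerivAt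
  rwa [← inner_gradient_left] at h

/-- **Gradient fields have zero circulation around closed `C¹` loops**:
`∮_γ ∇Q · dℓ = ∫₀¹ d/dσ Q(γ σ) dσ = Q(γ 1) − Q(γ 0) = 0` for a `C¹` potential `Q`. [folklore] -/
theorem tautLoopLoop_circulation_gradient {Q : E3 → ℝ} (hQ : ContDiff ℝ 1 Q) {γ : ℝ → E3}
    (hγ : IsC1Loop γ) : circulation (gradient Q) γ = 0 := by
  unfold circulation
  have hderiv : ∀ s ∈ uIcc (0:ℝ) 1,
      HasDerivAt (fun s => Q (γ s)) ⟪gradient Q (γ s), deriv γ s⟫ s := fun s _ =>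
    tautLoopLoop_hasDerivAt_comp_curve ((hQ.differentiable one_ne_zero) _) (hγ.differentiable s)
  rw [integral_eq_sub_of_hasDerivAt hderiv
    ((((tautLoopLoop_continuous_gradient hQ).comp hγ.continuous).inner
      hγ.continuous_deriv).intervalIntegrable 0 1), hγ.apply_zero_eq_apply_one, sub_self]

/-! ## Orientation reversal -/

/-- The velocity of the reversed loop: `(γ(1 − ·))′ σ = −γ′(1 − σ)` (junk values included).
[folklore] -/
theorem tautLoopLoop_deriv_reverse (γ : ℝ → E3) (σ : ℝ) :
    deriv (fun s => γ (1 - s)) σ = -deriv γ (1 - σ) :=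
  deriv_comp_const_sub γ 1 σ

/-- Reversing the orientation of a closed `C¹` loop gives a closed `C¹` loop. [folklore] -/
theorem tautLoopLoop_isC1Loop_reverse {γ : ℝ → E3} (hγ : IsC1Loop γ) :
    IsC1Loop (fun s => γ (1 - s)) := by
  refine ⟨hγ.contDiff.comp (contDiff_const.sub contDiff_id), fun s => ?_⟩
  show γ (1 - (s + 1)) = γ (1 - s)
  rw [show (1 : ℝ) - (s + 1) = (1 - s) - 1 by ring, hγ.periodic.sub_eq]

/-- Reversal preserves the length: `∫₀¹ ‖(γ(1 − ·))′‖ = ∫₀¹ ‖γ′‖` (substitution `σ ↦ 1 − σ`).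
[folklore] -/
theorem tautLoopLoop_len_reverse (γ : ℝ → E3) :
    (∫ σ in (0:ℝ)..1, ‖deriv (fun s => γ (1 - s)) σ‖) = ∫ σ in (0:ℝ)..1, ‖deriv γ σ‖ := by
  simp only [tautLoopLoop_deriv_reverse, norm_neg]
  rw [intervalIntegral.integral_comp_sub_left (fun σ => ‖deriv γ σ‖) 1]
  norm_num

/-- Reversal preserves the compression numerator `∫₀¹ −⟪γ′, Dv(γ) γ′⟫ / ‖γ′‖`: the integrand is
even in the velocity, then substitution `σ ↦ 1 − σ`. [folklore] -/
theorem tautLoopLoop_compression_reverse (v : E3 → E3) (γ : ℝ → E3) :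
    (∫ σ in (0:ℝ)..1, -(inner ℝ (deriv (fun s => γ (1 - s)) σ)
        (fderiv ℝ v (γ (1 - σ)) (deriv (fun s => γ (1 - s)) σ))) /
          ‖deriv (fun s => γ (1 - s)) σ‖) =
      ∫ σ in (0:ℝ)..1, -(inner ℝ (deriv γ σ) (fderiv ℝ v (γ σ) (deriv γ σ))) / ‖deriv γ σ‖ := by
  simp only [tautLoopLoop_deriv_reverse, norm_neg, map_neg, inner_neg_neg]
  rw [intervalIntegral.integral_comp_sub_left
    (fun σ => -(inner ℝ (deriv γ σ) (fderiv ℝ v (γ σ) (deriv γ σ))) / ‖deriv γ σ‖) 1]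
  norm_num

/-- **Orientation reversal, packaged.** For a closed `C¹` loop `γ`, the reversed loop
`σ ↦ γ(1 − σ)` is a closed `C¹` loop with the same length and the same compression numerator,
and with the opposite circulation for every field. [folklore] -/
theorem tautLoopLoop_reverse {γ : ℝ → E3} (hγ : IsC1Loop γ) :
    IsC1Loop (fun s => γ (1 - s)) ∧
    (∫ σ in (0:ℝ)..1, ‖deriv (fun s => γ (1 - s)) σ‖) = (∫ σ in (0:ℝ)..1, ‖deriv γ σ‖) ∧
    (∀ v : E3 → E3, Continuous v → circulation v (fun s => γ (1 - s)) = - circulation v γ) ∧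
    (∀ v : E3 → E3, ContDiff ℝ 1 v →
      (∫ σ in (0:ℝ)..1, -(inner ℝ (deriv (fun s => γ (1 - s)) σ)
        (fderiv ℝ v (γ (1 - σ)) (deriv (fun s => γ (1 - s)) σ))) /
          ‖deriv (fun s => γ (1 - s)) σ‖) =
      (∫ σ in (0:ℝ)..1, -(inner ℝ (deriv γ σ) (fderiv ℝ v (γ σ) (deriv γ σ))) / ‖deriv γ σ‖)) :=
  ⟨tautLoopLoop_isC1Loop_reverse hγ, tautLoopLoop_len_reverse γ,
    fun v _ => circulation_comp_one_sub v γ, fun v _ => tautLoopLoop_compression_reverse v γ⟩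

/-! ## The adjoint chain rule for gradients -/

/-- **Adjoint chain rule for gradients** (pull-backs of exact `1`-forms are exact): for a `C¹`
map `A` and a differentiable potential `Q`, `(DA(x))† ∇Q(A x) = ∇(Q ∘ A)(x)`; both sides pair
with `e` to `DQ(A x)(DA(x) e)`. [folklore] -/
theorem tautLoopLoop_adjoint_gradient_comp {A : E3 → E3} {Q : E3 → ℝ} (hA : ContDiff ℝ 1 A)
    (hQ : Differentiable ℝ Q) (x : E3) :
    adjoint (fderiv ℝ A x) (gradient Q (A x)) = gradient (Q ∘ A) x := by
  have h : HasFDerivAt (Q ∘ A) ((fderiv ℝ Q (A x)).comp (fderiv ℝ A x)) x :=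
    (hQ (A x)).hasFDerivAt.comp x ((hA.differentiable one_ne_zero) x).hasFDerivAt
  refine ext_inner_right ℝ fun e => ?_
  rw [ContinuousLinearMap.adjoint_inner_left, inner_gradient_left, inner_gradient_left, h.fderiv,
    ContinuousLinearMap.comp_apply]

/-! ## The stub -/

/-- **Loop-side bookkeeping for the selection** (tools stub `stub_tautLoopStepLoopSideTools`):
(1) gradient fields have zero circulation around closed `C¹` loops; (2) reversing a closed `C¹`
loop keeps `IsC1Loop`, the length and the compression numerator and flips the circulation;
(3) `|∮_γ v · dℓ| ≤ sup_γ ‖v‖ · len γ` (tree `tautLoopLlc_abs_circulation_le`);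
(4) `(DA(x))† ∇Q(A x) = ∇(Q ∘ A)(x)`. [folklore] -/
theorem stub_tautLoopStepLoopSideTools : (∀ (Q : EuclideanSpace ℝ (Fin 3) → ℝ) (γ : ℝ → EuclideanSpace ℝ (Fin 3)), ContDiff ℝ 1 Q → Literature.Analysis.FluidPDE.IsC1Loop γ → Literature.Analysis.FluidPDE.circulation (gradient Q) γ = 0) ∧ (∀ (γ : ℝ → EuclideanSpace ℝ (Fin 3)), Literature.Analysis.FluidPDE.IsC1Loop γ → Literature.Analysis.FluidPDE.IsC1Loop (fun s => γ (1 - s)) ∧ (∫ σ in (0:ℝ)..1, ‖deriv (fun s => γ (1 - s)) σ‖) = (∫ σ in (0:ℝ)..1, ‖deriv γ σ‖) ∧ (∀ v : EuclideanSpace ℝ (Fin 3) → EuclideanSpace ℝ (Fin 3), Continuous v → Literature.Analysis.FluidPDE.circulation v (fun s => γ (1 - s)) = - Literature.Analysis.FluidPDE.circulation v γ) ∧ (∀ v : EuclideanSpace ℝ (Fin 3) → EuclideanSpace ℝ (Fin 3), ContDiff ℝ 1 v → (∫ σ in (0:ℝ)..1, -(inner ℝ (deriv (fun s => γ (1 -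 s)) σ) (fderiv ℝ v (γ (1 - σ)) (deriv (fun s => γ (1 - s)) σ))) / ‖deriv (fun s => γ (1 - s)) σ‖) = (∫ σ in (0:ℝ)..1, -(inner ℝ (deriv γ σ) (fderiv ℝ v (γ σ) (deriv γ σ))) / ‖deriv γ σ‖))) ∧ (∀ (v : EuclideanSpace ℝ (Fin 3) → EuclideanSpace ℝ (Fin 3)) (γ : ℝ → EuclideanSpace ℝ (Fin 3)) (B : ℝ), Continuous v → Literature.Analysis.FluidPDE.IsC1Loop γ → (∀ σ, ‖v (γ σ)‖ ≤ B) → |Literature.Analysis.FluidPDE.circulation v γ| ≤ B * (∫ σ in (0:ℝ)..1, ‖deriv γ σ‖)) ∧ (∀ (A : EuclideanSpace ℝ (Fin 3) → EuclideanSpace ℝ (Fin 3)) (Q : EuclideanSpace ℝ (Fin 3) → ℝ), ContDiff ℝ 1 A → Differentiable ℝ Q → ∀ x, ContinuousLinearMap.adjoint (fderiv ℝ A x) (gradient Q (A x)) = gradient (Q ∘ A) x) :=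
  ⟨fun _ _ hQ hγ => tautLoopLoop_circulation_gradient hQ hγ,
    fun _ hγ => tautLoopLoop_reverse hγ,
    fun _ _ _ hv hγ hB => tautLoopLlc_abs_circulation_le hv hγ hB,
    fun _ _ hA hQ x => tautLoopLoop_adjoint_gradient_comp hA hQ x⟩

end Summit.NavierStokesRegularity.NavierStokesRegularity.Theorems
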